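import Mathlib

/-!
# MatrixMultiplication / AutomaticSTPPDesigns — `RegularTowerGap`, submultiplicativity of entry sums

Route `AutomaticSTPPDesigns`, crux `RegularTowerGap` (stmt-MatrixMultiplication-7358), line
`Sketch`, stub `stub_entrySum_submul`.

For an `ℕ`-valued matrix cocycle `T k w q q'` over index words `w : Fin k → ι` (multiplicative along
`Fin.append`) and a set `R` of states that contains every intermediate state of a nonzero product
between members of `R`, the trimmed entry sums
`Z_τ(k) = ∑_w ∑_{q, q' ∈ R} T(k, w, q, q')^τ` are submultiplicative for `0 < τ ≤ 1`:
`Z_τ(k + l) ≤ Z_τ(k) · Z_τ(l)`.  Purely elementary (`(∑ y)^τ ≤ ∑ y^τ`, and a sum of products of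
nonnegative terms is at most the product of the sums).
-/

-- the tree's namespace `Summit.MatrixMultiplication.MatrixMultiplication.…` repeats a component by
-- design
set_option linter.dupNamespace false

noncomputable section

open Finset

open scoped BigOperators Classical

namespace Summit.MatrixMultiplication.MatrixMultiplication.Theorems.RegularTowerGap

/-- Subadditivity of `t ↦ t ^ s` (`0 < s ≤ 1`) over finite sums of nonnegative reals. [folklore] -/
theorem entrySum_rpow_sum_le_sum_rpow {α : Type*} (s : Finset α) (f : α → ℝ)
    (hf : ∀ i ∈ s, 0 ≤ f i) {τ : ℝ} (hτ : 0 < τ) (hτ1 : τ ≤ 1) :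
    (∑ i ∈ s, f i) ^ τ ≤ ∑ i ∈ s, f i ^ τ := by
  -- adapted from Literature.Probability.Moments.rpow_sum_le_sum_rpow
  induction s using Finset.induction_on with
  | empty => simp [Real.zero_rpow hτ.ne']
  | insert a s ha ih =>
    have hf' : ∀ i ∈ s, 0 ≤ f i := fun i hi => hf i (Finset.mem_insert_of_mem hi)
    rw [Finset.sum_insert ha, Finset.sum_insert ha]
    calc (f a + ∑ i ∈ s, f i) ^ τ ≤ f a ^ τ + (∑ i ∈ s, f i) ^ τ :=
          Real.rpow_add_le_add_rpow (hf a (Finset.mem_insert_self a s)) (Finset.sum_nonneg hf')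
            hτ.le hτ1
      _ ≤ f a ^ τ + ∑ i ∈ s, f i ^ τ := by gcongr; exact ih hf'

/-- A sum of products of nonnegative terms is at most the product of the sums. [folklore] -/
theorem entrySum_sum_mul_le_sum_mul_sum {α : Type*} (s : Finset α) (a b : α → ℝ)
    (ha : ∀ i ∈ s, 0 ≤ a i) (hb : ∀ i ∈ s, 0 ≤ b i) :
    ∑ i ∈ s, a i * b i ≤ (∑ i ∈ s, a i) * ∑ i ∈ s, b i := by
  rw [Finset.sum_mul_sum]
  exact Finset.sum_le_sum fun i hi =>
    Finset.single_le_sum (f := fun j => a i * b j) (fun j hj => mul_nonneg (ha i hi) (hb j hj)) hi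

/-- Rearrangement of a fourfold sum of products of independent factors into a product of two
triple sums. [folklore] -/
theorem entrySum_sum_sum_factor {α β γ : Type*} [Fintype α] [Fintype β] (s : Finset γ)
    (a : α → γ → γ → ℝ) (b : β → γ → γ → ℝ) :
    ∑ u, ∑ v, ∑ q ∈ s, ∑ q'' ∈ s, (∑ q' ∈ s, a u q q') * (∑ q' ∈ s, b v q' q'') =
      (∑ u, ∑ q ∈ s, ∑ q' ∈ s, a u q q') * ∑ v, ∑ q ∈ s, ∑ q' ∈ s, b v q q' := by
  rw [Finset.sum_mul_sum]
  refine Finset.sum_congr rfl fun u _ => Finset.sum_congr rfl fun v _ => ?_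
  rw [Finset.sum_mul_sum]
  refine Finset.sum_congr rfl fun q _ => ?_
  rw [← Finset.mul_sum, ← Finset.mul_sum]
  congr 1
  exact Finset.sum_comm

/-- Pointwise step: for `q, q'' ∈ R`, the `τ`-th power of an entry of the product matrix is at most
the sum over intermediate states `q' ∈ R` of the products of the `τ`-th powers of the factors
(`T (uv) = ∑_{q'} T u · T v`, the terms with `q' ∉ R` vanish, `(∑ y)^τ ≤ ∑ y^τ` and
`(xy)^τ = x^τ y^τ`). [folklore] -/
theorem entrySum_rpow_entry_le {ι σ : Type} [Fintype σ]
    (T : (k : ℕ) → (Fin k → ι) → σ → σ → ℕ) (R : Finset σ) {τ : ℝ} (hτ : 0 < τ) (hτ1 : τ ≤ 1)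
    (hmul : ∀ (k l : ℕ) (u : Fin k → ι) (v : Fin l → ι) (q q'' : σ),
      T (k + l) (Fin.append u v) q q'' = ∑ q', T k u q q' * T l v q' q'')
    (hR : ∀ (k l : ℕ) (u : Fin k → ι) (v : Fin l → ι) (q q' q'' : σ), q ∈ R → q'' ∈ R →
      T k u q q' ≠ 0 → T l v q' q'' ≠ 0 → q' ∈ R)
    (k l : ℕ) (u : Fin k → ι) (v : Fin l → ι) {q q'' : σ} (hq : q ∈ R) (hq'' : q'' ∈ R) :
    ((T (k + l) (Fin.append u v) q q'' : ℕ) : ℝ) ^ τ ≤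
      ∑ q' ∈ R, ((T k u q q' : ℕ) : ℝ) ^ τ * ((T l v q' q'' : ℕ) : ℝ) ^ τ := by
  have hsum : T (k + l) (Fin.append u v) q q'' = ∑ q' ∈ R, T k u q q' * T l v q' q'' := by
    rw [hmul]
    refine (Finset.sum_subset (Finset.subset_univ R) fun x _ hx => ?_).symm
    by_contra h
    exact hx (hR k l u v q x q'' hq hq'' (mul_ne_zero_iff.mp h).1 (mul_ne_zero_iff.mp h).2)
  rw [hsum, Nat.cast_sum]
  calc (∑ q' ∈ R, ((T k u q q' * T l v q' q'' : ℕ) : ℝ)) ^ τ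
      ≤ ∑ q' ∈ R, ((T k u q q' * T l v q' q'' : ℕ) : ℝ) ^ τ :=
        entrySum_rpow_sum_le_sum_rpow R _ (fun i _ => Nat.cast_nonneg _) hτ hτ1
    _ = ∑ q' ∈ R, ((T k u q q' : ℕ) : ℝ) ^ τ * ((T l v q' q'' : ℕ) : ℝ) ^ τ := by
        refine Finset.sum_congr rfl fun q' _ => ?_
        rw [Nat.cast_mul]
        exact Real.mul_rpow (Nat.cast_nonneg _) (Nat.cast_nonneg _)

/-- **Entry sums of a multiplicative ℕ-valued cocycle over a convex state set are
submultiplicative**: `T (uv) = ∑_{q'} T u · T v`, the intermediate `q'` of a nonzero product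
between members of `R` lies in `R`, `(∑ y)^τ ≤ ∑ y^τ` for `0 < τ ≤ 1`, and a sum of products of
nonnegative terms is at most the product of the sums. [folklore] -/
theorem stub_entrySum_submul :
    ∀ (ι σ : Type) [Fintype ι] [Fintype σ] (T : (k : ℕ) → (Fin k → ι) → σ → σ → ℕ)
      (R : Finset σ) (τ : ℝ), 0 < τ → τ ≤ 1 →
      (∀ (k l : ℕ) (u : Fin k → ι) (v : Fin l → ι) (q q'' : σ),
        T (k + l) (Fin.append u v) q q'' = ∑ q', T k u q q' * T l v q' q'') →
      (∀ (k l : ℕ) (u : Fin k → ι) (v : Fin l → ι) (q q' q'' : σ), q ∈ R → q'' ∈ R →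
        T k u q q' ≠ 0 → T l v q' q'' ≠ 0 → q' ∈ R) →
      ∀ k l : ℕ,
        (∑ w : Fin (k + l) → ι, ∑ q ∈ R, ∑ q' ∈ R, ((T (k + l) w q q' : ℕ) : ℝ) ^ τ) ≤
          (∑ u : Fin k → ι, ∑ q ∈ R, ∑ q' ∈ R, ((T k u q q' : ℕ) : ℝ) ^ τ) *
            ∑ v : Fin l → ι, ∑ q ∈ R, ∑ q' ∈ R, ((T l v q q' : ℕ) : ℝ) ^ τ := by
  intro ι σ _ _ T R τ hτ hτ1 hmul hR k l
  -- reindex the words of length `k + l` as concatenations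
  have hre : (∑ w : Fin (k + l) → ι, ∑ q ∈ R, ∑ q' ∈ R, ((T (k + l) w q q' : ℕ) : ℝ) ^ τ) =
      ∑ u : Fin k → ι, ∑ v : Fin l → ι,
        ∑ q ∈ R, ∑ q' ∈ R, ((T (k + l) (Fin.append u v) q q' : ℕ) : ℝ) ^ τ := by
    rw [← (Fin.appendEquiv k l).sum_comp, Fintype.sum_prod_type]
    rfl
  rw [hre]
  calc ∑ u : Fin k → ι, ∑ v : Fin l → ι,
        ∑ q ∈ R, ∑ q'' ∈ R, ((T (k + l) (Fin.append u v) q q'' : ℕ) : ℝ) ^ τ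
      ≤ ∑ u : Fin k → ι, ∑ v : Fin l → ι, ∑ q ∈ R, ∑ q'' ∈ R,
          ∑ q' ∈ R, ((T k u q q' : ℕ) : ℝ) ^ τ * ((T l v q' q'' : ℕ) : ℝ) ^ τ :=
        Finset.sum_le_sum fun u _ => Finset.sum_le_sum fun v _ => Finset.sum_le_sum fun q hq =>
          Finset.sum_le_sum fun q'' hq'' =>
            entrySum_rpow_entry_le T R hτ hτ1 hmul hR k l u v hq hq''
    _ ≤ ∑ u : Fin k → ι, ∑ v : Fin l → ι, ∑ q ∈ R, ∑ q'' ∈ R,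
          (∑ q' ∈ R, ((T k u q q' : ℕ) : ℝ) ^ τ) * ∑ q' ∈ R, ((T l v q' q'' : ℕ) : ℝ) ^ τ :=
        Finset.sum_le_sum fun u _ => Finset.sum_le_sum fun v _ => Finset.sum_le_sum fun q _ =>
          Finset.sum_le_sum fun q'' _ =>
            entrySum_sum_mul_le_sum_mul_sum R _ _
              (fun _ _ => Real.rpow_nonneg (Nat.cast_nonneg _) _)
              fun _ _ => Real.rpow_nonneg (Nat.cast_nonneg _) _
    _ = (∑ u : Fin k → ι, ∑ q ∈ R, ∑ q' ∈ R, ((T k u q q' : ℕ) : ℝ) ^ τ) *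
          ∑ v : Fin l → ι, ∑ q ∈ R, ∑ q' ∈ R, ((T l v q q' : ℕ) : ℝ) ^ τ :=
        entrySum_sum_sum_factor R (fun u q q' => ((T k u q q' : ℕ) : ℝ) ^ τ)
          fun v q q' => ((T l v q q' : ℕ) : ℝ) ^ τ

end Summit.MatrixMultiplication.MatrixMultiplication.Theorems.RegularTowerGap

end
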